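import Literature.Algebra.EuclideanLattices.RegevQuantumPartFibres
import Literature.Computability.QuantumComplexity.QFTQubitsTensor
import Literature.Computability.QuantumComplexity.UncomputeBranches
import Literature.Computability.QuantumComplexity.GaussianCellsPoint
import HarnessLib

/-!
# Regev 2009, Lemma 3.14 (machine form), II: the erased register state against the branch state

Topic `Algebra/EuclideanLattices` (family `pqc`), sequel of `RegevQuantumPartFibres.lean`. On the
registers of the machine (the tree's model: `QReg W`, `basisState`, matrices acting by `*ᵥ`, `l2Norm`;
classical reversible blocks as basis maps `IsBasisMap M κ` of `UncomputeBranches.lean`) the state after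
the box Gaussian `Z⁻¹ Σ_{x ∈ Box} ρ(x) |lab₀ x⟩` has gone through the classical stage `κc` (reduction
`y(x)`, coset index `s(x)`, erasure of `x` exact on the good points, Regev 2009, Lemma 3.14, proof) is

  `Φ = Z⁻¹ Σ_{x ∈ Box} ρ(x) |κc (lab₀ x)⟩ = Z⁻¹ (Σ_{y,s} clean(y,s) |y, s⟩ + Σ_{x bad} ρ(x) |garbage_x⟩)`

(`embed`, `phiState`), and the state the analysis wants is `Φ′ = Z⁻¹ Σ_{y,s} ψ_y(s) |y, s⟩` (`phiIdeal`) —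
the branch vectors of `RegevBranchState.lean` written on the coefficient registers `S` over the branch
content `base y` (`labB y s = (base y)[S ↦ enc s]`). This file proves, from the fibre bookkeeping of part I
and the register hypotheses `QPart.RegHyps` (final labels injective on the box, clean labels of good
points, branch contents separated off the `S` wires, `enc` read back by `uVal`):

* `normSq_embed_of_injOn` (isometry), `IsBasisMap.mulVec_embed` (classical blocks relabel),
  `labB_injOn`, `uVal_labB` (`u(labB y s) = s`);
* `phiState_eq` — the regrouping of `Φ` by fibres; **`l2Norm_phiState_sub_phiIdeal_le`** —
  `‖Φ − Φ′‖₂ ≤ 2 Z⁻¹ (Σ_{y,s} τ_y(s)²)^{1/2}`; `l2Norm_phiState` (`= 1`), `l2Norm_phiIdeal` (`= Z′/Z`);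
* **`QPart.l2Norm_phiState_sub_phiIdeal_le_of_small`** — with `C = e^{2πBY} 2⁻ⁿ/κ ≤ 1/2`
  (`RegevQuantumPartFibres.sum_tail_sq_le`): `‖Φ − Φ′‖₂ ≤ 4C` and `Z ≤ Z′ ≤ 2Z`.

Everything here is proved; definitions have bodies; no named fact is introduced. The Fourier stage and
the measured law (via `Regev2009.lemma_3_14_ideal_aux`) are the sequel.

## References

* O. Regev, *On lattices, learning with errors, random linear codes, and cryptography*, J. ACM 56
  (2009), art. 34; arXiv:2401.03703, Lemma 3.12 (proof), Lemma 3.14 (proof) [Regev2009].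
* M. A. Nielsen, I. L. Chuang, *Quantum Computation and Quantum Information*, CUP 2010, §3.2.5, §4.4
  [NielsenChuang2010].
-/

noncomputable section

open Module Metric Finset _root_.Matrix
open scoped Real InnerProductSpace ENNReal

namespace Literature.Algebra.EuclideanLattices

namespace Regev2009

namespace QPart

open Literature.Computability.Cryptography Literature.Computability.QuantumComplexity
  Literature.Computability.QuantumComplexity.QState Literature.Computability.QuantumComplexity.QFTQubits

variable {V : Type*} {W : ℕ}

/-! ### Embedded vectors `Σ_{x ∈ T} a(x) |lab x⟩` -/

/-- **The embedded vector** `Σ_{x ∈ T} a(x) |lab x⟩` of an amplitude function on a finite set of points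
under a label map. [cite: NielsenChuang2010, §4.4] -/
def embed (T : Finset V) (a : V → ℂ) (lab : V → QReg W) : QReg W → ℂ := ∑ x ∈ T, a x • basisState (lab x)

/-- **Isometry**: for a label map injective on `T`, `normSq (Σ a(x)|lab x⟩) = Σ |a(x)|²`. [cite: NielsenChuang2010, §2.1.4] -/
theorem normSq_embed_of_injOn {T : Finset V} {lab : V → QReg W} (hinj : Set.InjOn lab T) (a : V → ℂ) :
    normSq (embed T a lab) = ∑ x ∈ T, ‖a x‖ ^ 2 := by
  classical
  have h1 : embed T a lab = ∑ x : T, a x • basisState (lab x) := by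
    unfold embed; rw [← sum_coe_sort]
  have hinj' : Function.Injective fun x : T => lab x := fun x x' h => Subtype.ext (hinj x.2 x'.2 h)
  rw [h1, GaussianCells.normSq_sum_smul_basisState hinj', sum_coe_sort T (fun x => ‖a x‖ ^ 2)]

/-- The same for `l2Norm`. [cite: NielsenChuang2010, §2.1.4] -/
theorem l2Norm_embed_of_injOn {T : Finset V} {lab : V → QReg W} (hinj : Set.InjOn lab T) (a : V → ℂ) :
    l2Norm (embed T a lab) = Real.sqrt (∑ x ∈ T, ‖a x‖ ^ 2) := by
  rw [l2Norm_eq_sqrt_normSq, normSq_embed_of_injOn hinj]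

/-- **Classical blocks relabel**: a basis map along `κ` sends `Σ a(x)|lab x⟩` to `Σ a(x)|κ (lab x)⟩`.
[cite: NielsenChuang2010, §3.2.5] -/
theorem _root_.Literature.Computability.QuantumComplexity.IsBasisMap.mulVec_embed {M : Matrix (QReg W) (QReg W) ℂ}
    {κ : QReg W → QReg W} (h : IsBasisMap M κ) (T : Finset V) (a : V → ℂ) (lab : V → QReg W) :
    M *ᵥ embed T a lab = embed T a (κ ∘ lab) := by
  unfold embed
  rw [Matrix.mulVec_sum]
  refine sum_congr rfl fun x _ => ?_
  rw [Matrix.mulVec_smul, h]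
  rfl

/-- Splitting an embedded vector along a predicate. [folklore] -/
theorem embed_eq_add_filter (T : Finset V) (a : V → ℂ) (lab : V → QReg W) (P : V → Prop) [DecidablePred P] :
    embed T a lab = embed (T.filter P) a lab + embed (T.filter fun x => ¬ P x) a lab := by
  unfold embed; rw [sum_filter_add_sum_filter_not]

/-- Scaling an embedded vector. [folklore] -/
theorem embed_smul (T : Finset V) (c : ℂ) (a : V → ℂ) (lab : V → QReg W) :
    embed T (fun x => c * a x) lab = c • embed T a lab := by
  unfold embed; rw [smul_sum]; refine sum_congr rfl fun x _ => ?_; rw [smul_smul]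

/-! ### The registers: branch labels, the numeral read back -/

variable {m κ : ℕ}

/-- **The big-endian numeral** of a block content (bit `0` most significant), as `QFTQubits.uVal` reads it.
[cite: NielsenChuang2010, §5.1] -/
def valBE (u : Fin κ → Bool) : ℕ := ∑ j : Fin κ, if u j then 2 ^ (κ - 1 - (j : ℕ)) else 0

/-- `uVal` of a block of `writeAll` is the numeral of the written content. [folklore] -/
theorem uVal_writeAll {S : Fin m → (Fin κ ↪ Fin W)} (hdis : ∀ i i', i ≠ i' → Disjoint (Set.range (S i)) (Set.range (S i')))
    (c : QReg W) (T : Fin m → Fin κ → Bool) (i : Fin m) : uVal (S i) (writeAll S c T) = valBE (T i) := by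
  unfold uVal valBE
  refine sum_congr rfl fun j _ => ?_
  rw [writeAll_apply_ws hdis]

/-- Overwriting all blocks twice keeps the last content. [folklore] -/
theorem writeAll_writeAll {S : Fin m → (Fin κ ↪ Fin W)} (hdis : ∀ i i', i ≠ i' → Disjoint (Set.range (S i)) (Set.range (S i')))
    (c : QReg W) (T T' : Fin m → Fin κ → Bool) : writeAll S (writeAll S c T') T = writeAll S c T := by
  funext q
  by_cases h : ∃ p : Fin m × Fin κ, S p.1 p.2 = q
  · obtain ⟨⟨i, j⟩, rfl⟩ := h
    rw [writeAll_apply_ws hdis, writeAll_apply_ws hdis]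
  · have hq : ∀ i j, S i j ≠ q := fun i j e => h ⟨(i, j), e⟩
    rw [writeAll_apply_of_forall_ne S _ _ hq, writeAll_apply_of_forall_ne S _ _ hq, writeAll_apply_of_forall_ne S _ _ hq]

/-- Off the blocks, `writeAll` keeps the base content. [folklore] -/
theorem writeAll_apply_off {S : Fin m → (Fin κ ↪ Fin W)} (c : QReg W) (T : Fin m → Fin κ → Bool) {q : Fin W}
    (hq : ∀ i j, S i j ≠ q) : writeAll S c T q = c q :=
  writeAll_apply_of_forall_ne S c T hq

variable (S : Fin m → (Fin κ ↪ Fin W)) (base : V → QReg W) (enc : ZMod (2 ^ κ) → Fin κ → Bool)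

/-- **The clean label of the branch `y` with coefficient content `s`**: the branch content `base y` with the
blocks `S` holding the codes of `s`. [cite: Regev2009, Lemma 3.14 (proof: the registers after the uncomputation)] -/
def labB (y : V) (s : Fin m → ZMod (2 ^ κ)) : QReg W := writeAll S (base y) (fun i => enc (s i))

/-- **The register hypotheses** of the classical stage: the final labels are injective on the box, good
points get the clean label of their branch, distinct branches are told apart off the `S` wires, the
blocks are disjoint, and the code `enc` is read back by the big-endian numeral. [cite: Regev2009, Lemma 3.14 (proof)] -/
structure RegHyps (Box : Finset V) (yOf : V → V) (sOf : V → Fin m → ZMod (2 ^ κ)) (Good : V → Prop)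
    (lab₀ : V → QReg W) (κc : QReg W → QReg W) : Prop where
  /-- the final labels are injective on the box -/
  lab_inj : Set.InjOn (κc ∘ lab₀) Box
  /-- good points get the clean label of their branch -/
  clean : ∀ x ∈ Box, Good x → κc (lab₀ x) = labB S base enc (yOf x) (sOf x)
  /-- distinct branches differ off the `S` wires -/
  base_sep : ∀ x ∈ Box, ∀ x' ∈ Box, yOf x ≠ yOf x' → ∃ q, (∀ i j, S i j ≠ q) ∧ base (yOf x) q ≠ base (yOf x') q
  /-- the blocks are pairwise disjoint -/
  hdis : ∀ i i', i ≠ i' → Disjoint (Set.range (S i)) (Set.range (S i'))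
  /-- the code is read back by the numeral -/
  enc_val : ∀ r : ZMod (2 ^ κ), valBE (enc r) = r.val

variable {S base enc}
variable {Box : Finset V} {yOf : V → V} {sOf : V → Fin m → ZMod (2 ^ κ)} {Good : V → Prop}
  {lab₀ : V → QReg W} {κc : QReg W → QReg W}

/-- The code is injective. [folklore] -/
theorem enc_injective (hR : RegHyps S base enc Box yOf sOf Good lab₀ κc) : Function.Injective enc := fun r r' h =>
  ZMod.val_injective _ (by rw [← hR.enc_val r, ← hR.enc_val r', h])

/-- **`u(labB y s) = s`**: the numeral read off block `i` of a clean label is `sᵢ`. [folklore] -/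
theorem uVal_labB (hR : RegHyps S base enc Box yOf sOf Good lab₀ κc) (y : V) (s : Fin m → ZMod (2 ^ κ)) (i : Fin m) :
    ((uVal (S i) (labB S base enc y s) : ℕ) : ZMod (2 ^ κ)) = s i := by
  unfold labB
  rw [uVal_writeAll hR.hdis, hR.enc_val, ZMod.natCast_zmod_val]

/-- **Clean labels are injective on `y(Box) × ℤ_Rᵐ`.** [folklore] -/
theorem labB_injOn (hR : RegHyps S base enc Box yOf sOf Good lab₀ κc) {x x' : V} (hx : x ∈ Box) (hx' : x' ∈ Box)
    {s s' : Fin m → ZMod (2 ^ κ)} (h : labB S base enc (yOf x) s = labB S base enc (yOf x') s') :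
    yOf x = yOf x' ∧ s = s' := by
  have hy : yOf x = yOf x' := by
    by_contra hne
    obtain ⟨q, hq, hneq⟩ := hR.base_sep x hx x' hx' hne
    apply hneq
    have := congrFun h q
    unfold labB at this
    rwa [writeAll_apply_off _ _ hq, writeAll_apply_off _ _ hq] at this
  refine ⟨hy, ?_⟩
  unfold labB at h
  rw [hy] at h
  have h2 := writeAll_injective hR.hdis (base (yOf x')) h
  funext i
  exact enc_injective hR (congrFun h2 i)

/-! ### The two states -/

variable [NormedAddCommGroup V] [InnerProductSpace ℝ V]

/-- **The box norm** `Z = (Σ_{x ∈ Box} ρ(x)²)^{1/2}`. [cite: Regev2009, Lemma 3.12 (proof)] -/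
def zBox (Box : Finset V) : ℝ := Real.sqrt (∑ x ∈ Box, gaussianFunction 1 x ^ 2)

/-- **The erased register state** `Φ = Z⁻¹ Σ_{x ∈ Box} ρ(x) |κc (lab₀ x)⟩`. [cite: Regev2009, Lemma 3.14 (proof)] -/
def phiState (Box : Finset V) (lab₀ : V → QReg W) (κc : QReg W → QReg W) : QReg W → ℂ :=
  embed Box (fun x => (((gaussianFunction 1 x / zBox Box : ℝ)) : ℂ)) (κc ∘ lab₀)

variable (Λ : Submodule ℤ V) (e : Basis (Fin m) ℤ Λ)

/-- **The branch register state** `Φ′ = Z⁻¹ Σ_{y ∈ y(Box)} Σ_s ψ_y(s) |labB y s⟩`. [cite: Regev2009, Lemma 3.12 (proof), Lemma 3.14 (proof)] -/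
def phiIdeal [DecidableEq V] (S : Fin m → (Fin κ ↪ Fin W)) (base : V → QReg W) (enc : ZMod (2 ^ κ) → Fin κ → Bool)
    (Box : Finset V) (yOf : V → V) : QReg W → ℂ :=
  ∑ y ∈ Box.image yOf, ∑ s : Fin m → ZMod (2 ^ κ),
    (((branchAmp Λ e (2 ^ κ) Box y s / zBox Box : ℝ)) : ℂ) • basisState (labB S base enc y s)

variable {Λ e}

omit [InnerProductSpace ℝ V] in
/-- `Z > 0` for a nonempty box. [folklore] -/
theorem zBox_pos (hne : Box.Nonempty) : 0 < zBox Box := by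
  obtain ⟨x, hx⟩ := hne
  refine Real.sqrt_pos.2 (lt_of_lt_of_le (pow_pos (gaussianFunction_pos 1 x) 2) ?_)
  exact single_le_sum (f := fun x => gaussianFunction 1 x ^ 2) (fun _ _ => sq_nonneg _) hx

omit [InnerProductSpace ℝ V] in
/-- `Z² = Σ ρ(x)²`. [folklore] -/
theorem zBox_sq : zBox Box ^ 2 = ∑ x ∈ Box, gaussianFunction 1 x ^ 2 := Real.sq_sqrt (sum_nonneg fun _ _ => sq_nonneg _)

omit [InnerProductSpace ℝ V] in
/-- **`Φ` is a unit vector.** [folklore] -/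
theorem l2Norm_phiState (hR : RegHyps S base enc Box yOf sOf Good lab₀ κc) (hne : Box.Nonempty) : l2Norm (phiState Box lab₀ κc) = 1 := by
  unfold phiState
  rw [l2Norm_embed_of_injOn hR.lab_inj]
  have hZ := zBox_pos hne
  have h : ∑ x ∈ Box, ‖((((gaussianFunction 1 x / zBox Box : ℝ)) : ℂ))‖ ^ 2 = 1 := by
    simp_rw [Complex.norm_real, Real.norm_eq_abs, sq_abs, div_pow]
    rw [← sum_div, ← zBox_sq, div_self (pow_ne_zero _ hZ.ne')]
  rw [h, Real.sqrt_one]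

/-- **Regrouping `Φ` by fibres**: `Φ = Z⁻¹ Σ_{y,s} clean(y,s)|labB y s⟩ + Z⁻¹ Σ_{bad} ρ(x)|κc(lab₀ x)⟩`.
[cite: Regev2009, Lemma 3.14 (proof)] -/
theorem phiState_eq [DecidableEq V] [DecidablePred Good] (hH : FibreHyps Λ e (2 ^ κ) Box yOf sOf Good)
    (hR : RegHyps S base enc Box yOf sOf Good lab₀ κc) :
    phiState Box lab₀ κc =
      (∑ y ∈ Box.image yOf, ∑ s : Fin m → ZMod (2 ^ κ),
          (((cleanAmp Λ e (2 ^ κ) Good Box y s / zBox Box : ℝ)) : ℂ) • basisState (labB S base enc y s)) +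
        embed (Box.filter fun x => ¬ Good x) (fun x => (((gaussianFunction 1 x / zBox Box : ℝ)) : ℂ)) (κc ∘ lab₀) := by
  classical
  unfold phiState
  rw [embed_eq_add_filter Box _ _ Good]
  congr 1
  -- the good part, regrouped along `(y(x), s(x))`
  unfold embed
  have hmaps : ∀ x ∈ Box.filter Good, (yOf x, sOf x) ∈ (Box.image yOf) ×ˢ (univ : Finset (Fin m → ZMod (2 ^ κ))) :=
    fun x hx => mem_product.2 ⟨mem_image_of_mem _ (mem_filter.1 hx).1, mem_univ _⟩
  rw [← sum_fiberwise_of_maps_to hmaps, sum_product]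
  refine sum_congr rfl fun y hy => sum_congr rfl fun s _ => ?_
  obtain ⟨x₀, hx₀, rfl⟩ := mem_image.1 hy
  have hset : (Box.filter Good).filter (fun x => (yOf x, sOf x) = (yOf x₀, s)) = (fibre Λ e (2 ^ κ) Box (yOf x₀) s).filter Good := by
    rw [filter_filter, ← filter_yOf_sOf_eq_fibre hH hx₀ s, filter_filter]
    refine filter_congr fun x _ => ?_
    simp only [Prod.mk.injEq]; tauto
  rw [hset, cleanAmp, sum_div, Complex.ofReal_sum, sum_smul]
  refine sum_congr rfl fun x hx => ?_
  rw [mem_filter] at hx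
  obtain ⟨hxB, hyx, hsx⟩ := yOf_sOf_of_mem_fibre hH hx₀ hx.1
  simp only [Function.comp_apply]
  rw [hR.clean x hxB hx.2, hyx, hsx]

/-- **`‖Φ − Φ′‖₂ ≤ 2 Z⁻¹ (Σ_{y,s} τ_y(s)²)^{1/2}`**: the clean amplitudes are within the tails of the branch
amplitudes, and the bad points carry at most the tails. [cite: Regev2009, Lemma 3.14 (proof: "exponentially close")] -/
theorem l2Norm_phiState_sub_phiIdeal_le [DecidableEq V] [DecidablePred Good] (hH : FibreHyps Λ e (2 ^ κ) Box yOf sOf Good)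
    (hR : RegHyps S base enc Box yOf sOf Good lab₀ κc) (hne : Box.Nonempty) :
    l2Norm (phiState Box lab₀ κc - phiIdeal Λ e S base enc Box yOf) ≤
      2 / zBox Box * Real.sqrt (∑ y ∈ Box.image yOf, ∑ s : Fin m → ZMod (2 ^ κ), tailBranchAmp Λ e (2 ^ κ) Box y s ^ 2) := by
  classical
  have hZ := zBox_pos hne
  set TT : ℝ := ∑ y ∈ Box.image yOf, ∑ s : Fin m → ZMod (2 ^ κ), tailBranchAmp Λ e (2 ^ κ) Box y s ^ 2 with hTT
  -- the difference of the clean sums, and the bad part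
  set D₁ : QReg W → ℂ := ∑ y ∈ Box.image yOf, ∑ s : Fin m → ZMod (2 ^ κ),
      ((((cleanAmp Λ e (2 ^ κ) Good Box y s - branchAmp Λ e (2 ^ κ) Box y s) / zBox Box : ℝ)) : ℂ) •
        basisState (labB S base enc y s) with hD₁
  set D₂ : QReg W → ℂ := embed (Box.filter fun x => ¬ Good x) (fun x => (((gaussianFunction 1 x / zBox Box : ℝ)) : ℂ)) (κc ∘ lab₀)
    with hD₂
  have hdiff : phiState Box lab₀ κc - phiIdeal Λ e S base enc Box yOf = D₁ + D₂ := by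
    rw [phiState_eq hH hR, phiIdeal, hD₁, add_sub_right_comm, ← sum_sub_distrib]
    congr 1
    refine sum_congr rfl fun y _ => ?_
    rw [← sum_sub_distrib]
    refine sum_congr rfl fun s _ => ?_
    rw [← sub_smul, ← Complex.ofReal_sub, sub_div]
  -- `‖D₁‖ ≤ Z⁻¹ √TT`
  have hD₁n : l2Norm D₁ ≤ Real.sqrt TT / zBox Box := by
    -- as an embedded family over `y(Box) × ℤ_Rᵐ`
    have hfam : D₁ = ∑ p ∈ (Box.image yOf) ×ˢ (univ : Finset (Fin m → ZMod (2 ^ κ))),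
        ((((cleanAmp Λ e (2 ^ κ) Good Box p.1 p.2 - branchAmp Λ e (2 ^ κ) Box p.1 p.2) / zBox Box : ℝ)) : ℂ) •
          basisState (labB S base enc p.1 p.2) := by rw [hD₁, sum_product]
    have hinj : Set.InjOn (fun p : V × (Fin m → ZMod (2 ^ κ)) => labB S base enc p.1 p.2)
        ((Box.image yOf) ×ˢ (univ : Finset (Fin m → ZMod (2 ^ κ))) : Finset _) := by
      rintro ⟨y, s⟩ hp ⟨y', s'⟩ hp' h
      rw [coe_product, Set.mem_prod, mem_coe, mem_image] at hp hp'
      obtain ⟨⟨x, hx, rfl⟩, -⟩ := hp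
      obtain ⟨⟨x', hx', rfl⟩, -⟩ := hp'
      obtain ⟨hy, hs⟩ := labB_injOn hR hx hx' h
      rw [Prod.mk.injEq]; exact ⟨hy, hs⟩
    have hiso := GaussianCells.normSq_sum_smul_basisState
      (f := fun p : ((Box.image yOf) ×ˢ (univ : Finset (Fin m → ZMod (2 ^ κ))) : Finset _) => labB S base enc p.1.1 p.1.2)
      (fun p p' h => Subtype.ext (hinj p.2 p'.2 h))
      (fun p => ((((cleanAmp Λ e (2 ^ κ) Good Box p.1.1 p.1.2 - branchAmp Λ e (2 ^ κ) Box p.1.1 p.1.2) / zBox Box : ℝ)) : ℂ))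
    rw [sum_coe_sort ((Box.image yOf) ×ˢ univ) (fun p => ((((cleanAmp Λ e (2 ^ κ) Good Box p.1 p.2 -
        branchAmp Λ e (2 ^ κ) Box p.1 p.2) / zBox Box : ℝ)) : ℂ) • basisState (labB S base enc p.1 p.2)),
      sum_coe_sort ((Box.image yOf) ×ˢ univ) (fun p => ‖((((cleanAmp Λ e (2 ^ κ) Good Box p.1 p.2 -
        branchAmp Λ e (2 ^ κ) Box p.1 p.2) / zBox Box : ℝ)) : ℂ)‖ ^ 2)] at hiso
    rw [l2Norm_eq_sqrt_normSq, hfam, hiso, sum_product, le_div_iff₀ hZ, ← Real.sqrt_sq hZ.le, ← Real.sqrt_mul (by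
      exact sum_nonneg fun _ _ => sum_nonneg fun _ _ => sq_nonneg _), Real.sqrt_sq hZ.le]
    refine Real.sqrt_le_sqrt ?_
    rw [sum_mul, hTT]
    refine sum_le_sum fun y hy => ?_
    rw [sum_mul]
    refine sum_le_sum fun s _ => ?_
    obtain ⟨x₀, hx₀, rfl⟩ := mem_image.1 hy
    rw [Complex.norm_real, Real.norm_eq_abs, sq_abs, div_pow, div_mul_cancel₀ _ (pow_ne_zero _ hZ.ne')]
    exact sq_le_sq' (abs_le.1 (abs_cleanAmp_sub_branchAmp_le hH hx₀ s)).1 (abs_le.1 (abs_cleanAmp_sub_branchAmp_le hH hx₀ s)).2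
  -- `‖D₂‖ ≤ Z⁻¹ √TT`
  have hD₂n : l2Norm D₂ ≤ Real.sqrt TT / zBox Box := by
    rw [hD₂, l2Norm_embed_of_injOn (fun x hx x' hx' h => hR.lab_inj (mem_filter.1 hx).1 (mem_filter.1 hx').1 h),
      le_div_iff₀ hZ, ← Real.sqrt_sq hZ.le, ← Real.sqrt_mul (sum_nonneg fun _ _ => sq_nonneg _), Real.sqrt_sq hZ.le]
    refine Real.sqrt_le_sqrt ?_
    rw [sum_mul]
    calc ∑ x ∈ Box.filter (fun x => ¬ Good x), ‖((((gaussianFunction 1 x / zBox Box : ℝ)) : ℂ))‖ ^ 2 * zBox Box ^ 2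
        = ∑ x ∈ Box.filter (fun x => ¬ Good x), gaussianFunction 1 x ^ 2 := by
          refine sum_congr rfl fun x _ => ?_
          rw [Complex.norm_real, Real.norm_eq_abs, sq_abs, div_pow, div_mul_cancel₀ _ (pow_ne_zero _ hZ.ne')]
      _ ≤ TT := sum_normSq_bad_le hH
  calc l2Norm (phiState Box lab₀ κc - phiIdeal Λ e S base enc Box yOf) = l2Norm (D₁ + D₂) := by rw [hdiff]
    _ ≤ l2Norm D₁ + l2Norm D₂ := l2Norm_add_le _ _
    _ ≤ Real.sqrt TT / zBox Box + Real.sqrt TT / zBox Box := add_le_add hD₁n hD₂n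
    _ = 2 / zBox Box * Real.sqrt TT := by ring

/-- **`‖Φ′‖₂ = Z′/Z`**, `Z′ = (Σ_{y,s} ψ_y(s)²)^{1/2}`. [folklore] -/
theorem l2Norm_phiIdeal [DecidableEq V] (hR : RegHyps S base enc Box yOf sOf Good lab₀ κc) (hne : Box.Nonempty) :
    l2Norm (phiIdeal Λ e S base enc Box yOf) =
      Real.sqrt (∑ y ∈ Box.image yOf, ∑ s : Fin m → ZMod (2 ^ κ), branchAmp Λ e (2 ^ κ) Box y s ^ 2) / zBox Box := by
  classical
  have hZ := zBox_pos hne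
  have hfam : phiIdeal Λ e S base enc Box yOf = ∑ p ∈ (Box.image yOf) ×ˢ (univ : Finset (Fin m → ZMod (2 ^ κ))),
      (((branchAmp Λ e (2 ^ κ) Box p.1 p.2 / zBox Box : ℝ)) : ℂ) • basisState (labB S base enc p.1 p.2) := by
    rw [phiIdeal, sum_product]
  have hinj : Set.InjOn (fun p : V × (Fin m → ZMod (2 ^ κ)) => labB S base enc p.1 p.2)
      ((Box.image yOf) ×ˢ (univ : Finset (Fin m → ZMod (2 ^ κ))) : Finset _) := by
    rintro ⟨y, s⟩ hp ⟨y', s'⟩ hp' h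
    rw [coe_product, Set.mem_prod, mem_coe, mem_image] at hp hp'
    obtain ⟨⟨x, hx, rfl⟩, -⟩ := hp
    obtain ⟨⟨x', hx', rfl⟩, -⟩ := hp'
    obtain ⟨hy, hs⟩ := labB_injOn hR hx hx' h
    rw [Prod.mk.injEq]; exact ⟨hy, hs⟩
  have hiso := GaussianCells.normSq_sum_smul_basisState
    (f := fun p : ((Box.image yOf) ×ˢ (univ : Finset (Fin m → ZMod (2 ^ κ))) : Finset _) => labB S base enc p.1.1 p.1.2)
    (fun p p' h => Subtype.ext (hinj p.2 p'.2 h))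
    (fun p => (((branchAmp Λ e (2 ^ κ) Box p.1.1 p.1.2 / zBox Box : ℝ)) : ℂ))
  rw [sum_coe_sort ((Box.image yOf) ×ˢ univ) (fun p => (((branchAmp Λ e (2 ^ κ) Box p.1 p.2 / zBox Box : ℝ)) : ℂ) •
      basisState (labB S base enc p.1 p.2)),
    sum_coe_sort ((Box.image yOf) ×ˢ univ) (fun p => ‖(((branchAmp Λ e (2 ^ κ) Box p.1 p.2 / zBox Box : ℝ)) : ℂ)‖ ^ 2)] at hiso
  rw [l2Norm_eq_sqrt_normSq, hfam, hiso, sum_product, eq_div_iff hZ.ne', ← Real.sqrt_sq hZ.le,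
    ← Real.sqrt_mul (sum_nonneg fun _ _ => sum_nonneg fun _ _ => sq_nonneg _), Real.sqrt_sq hZ.le]
  congr 1
  rw [sum_mul]
  refine sum_congr rfl fun y _ => ?_
  rw [sum_mul]
  refine sum_congr rfl fun s _ => ?_
  rw [Complex.norm_real, Real.norm_eq_abs, sq_abs, div_pow, div_mul_cancel₀ _ (pow_ne_zero _ hZ.ne')]

/-- **The erased state is within `4C` of the branch state, and `Z ≤ Z′ ≤ 2Z`**, `C = e^{2πBY}2⁻ⁿ/κ ≤ 1/2`,
`κ = (1−δ)(1−b₁ⁿ)(1−4⁻ⁿ)`, under the hypotheses of `RegevBranchState` for every branch of the box.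
[cite: Regev2009, Lemma 3.12 (proof), Claim 3.13, Lemma 3.14 (proof)] -/
theorem l2Norm_phiState_sub_phiIdeal_le_of_small [FiniteDimensional ℝ V] [MeasurableSpace V] [BorelSpace V]
    [DiscreteTopology Λ] [IsZLattice ℝ Λ] [NeZero (2 ^ κ : ℕ)] [DecidableEq V] [DecidablePred Good] {B Y C : ℝ}
    (hH : FibreHyps Λ e (2 ^ κ) Box yOf sOf Good) (hR : RegHyps S base enc Box yOf sOf Good lab₀ κc) (hne : Box.Nonempty)
    (hsvΛ : ∀ z ∈ scaledLattice Λ (2 ^ κ), ‖z‖ < 2 * Real.sqrt (finrank ℝ V) → z = 0)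
    (hBox : ∀ x ∈ Box, BoxCoversShort Λ Box (yOf x)) (hY : ∀ x ∈ Box, ‖yOf x‖ ≤ Y)
    (hB : ∀ x ∈ Box, ∀ x' ∈ Box, ‖x - yOf x'‖ ≤ B)
    (hδ : π * (2 * Real.sqrt (finrank ℝ V) * Y + Y ^ 2) < 1)
    (hC : Real.exp (2 * π * B * Y) * (2⁻¹ : ℝ) ^ finrank ℝ V ≤
      C * ((1 - π * (2 * Real.sqrt (finrank ℝ V) * Y + Y ^ 2)) * (1 - banaConst ^ finrank ℝ V) * (1 - (4⁻¹ : ℝ) ^ finrank ℝ V)))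
    (hC2 : C ≤ 1 / 2) (hC0 : 0 ≤ C) :
    l2Norm (phiState Box lab₀ κc - phiIdeal Λ e S base enc Box yOf) ≤ 4 * C ∧
      zBox Box ≤ Real.sqrt (∑ y ∈ Box.image yOf, ∑ s : Fin m → ZMod (2 ^ κ), branchAmp Λ e (2 ^ κ) Box y s ^ 2) ∧
      Real.sqrt (∑ y ∈ Box.image yOf, ∑ s : Fin m → ZMod (2 ^ κ), branchAmp Λ e (2 ^ κ) Box y s ^ 2) ≤ 2 * zBox Box := by
  classical
  have hZ := zBox_pos hne
  set n := finrank ℝ V with hn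
  set κ₀ : ℝ := (1 - π * (2 * Real.sqrt n * Y + Y ^ 2)) * (1 - banaConst ^ n) * (1 - (4⁻¹ : ℝ) ^ n) with hκ₀
  set TT : ℝ := ∑ y ∈ Box.image yOf, ∑ s : Fin m → ZMod (2 ^ κ), tailBranchAmp Λ e (2 ^ κ) Box y s ^ 2 with hTT
  set ZP2 : ℝ := ∑ y ∈ Box.image yOf, ∑ s : Fin m → ZMod (2 ^ κ), branchAmp Λ e (2 ^ κ) Box y s ^ 2 with hZP2
  have hκ₀pos : 0 < κ₀ := by
    by_contra hle
    push Not at hle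
    have h3 : 0 < Real.exp (2 * π * B * Y) * (2⁻¹ : ℝ) ^ n := by positivity
    have h4 : C * κ₀ ≤ 0 := mul_nonpos_of_nonneg_of_nonpos hC0 hle
    linarith
  -- `κ₀² TT ≤ e^{4πBY} 4⁻ⁿ ZP2`, hence `√TT ≤ C √ZP2`
  have htail := sum_tail_sq_le (e := e) hsvΛ hBox hY hB hδ
  rw [← hκ₀, ← hTT, ← hZP2] at htail
  have hsqrtTT : Real.sqrt TT ≤ C * Real.sqrt ZP2 := by
    have h1 : TT ≤ (C * Real.sqrt ZP2) ^ 2 := by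
      have hZP2nn : 0 ≤ ZP2 := sum_nonneg fun _ _ => sum_nonneg fun _ _ => sq_nonneg _
      rw [mul_pow, Real.sq_sqrt hZP2nn]
      -- divide `htail` by `κ₀²`
      have hE : Real.exp (4 * π * B * Y) * (4⁻¹ : ℝ) ^ n = (Real.exp (2 * π * B * Y) * (2⁻¹ : ℝ) ^ n) ^ 2 := by
        rw [mul_pow, ← Real.exp_nat_mul, ← pow_mul]; congr 1; · push_cast; ring_nf
        · rw [show (2⁻¹ : ℝ) ^ (n * 2) = ((2⁻¹ : ℝ) ^ 2) ^ n by rw [mul_comm, pow_mul]]; norm_num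
      rw [hE] at htail
      have h3 : (Real.exp (2 * π * B * Y) * (2⁻¹ : ℝ) ^ n) ^ 2 ≤ (C * κ₀) ^ 2 :=
        pow_le_pow_left₀ (by positivity) hC 2
      have h4 : κ₀ ^ 2 * TT ≤ (C * κ₀) ^ 2 * ZP2 := htail.trans (mul_le_mul_of_nonneg_right h3 hZP2nn)
      have h5 : κ₀ ^ 2 * TT ≤ κ₀ ^ 2 * (C ^ 2 * ZP2) :=
        calc κ₀ ^ 2 * TT ≤ (C * κ₀) ^ 2 * ZP2 := h4
          _ = κ₀ ^ 2 * (C ^ 2 * ZP2) := by ring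
      exact le_of_mul_le_mul_left h5 (pow_pos hκ₀pos 2)
    calc Real.sqrt TT ≤ Real.sqrt ((C * Real.sqrt ZP2) ^ 2) := Real.sqrt_le_sqrt h1
      _ = C * Real.sqrt ZP2 := Real.sqrt_sq (mul_nonneg hC0 (Real.sqrt_nonneg _))
  -- `Z ≤ Z′ ≤ Z + √TT ≤ Z + C Z′`, so `Z′ ≤ 2Z`
  have hZ'ub : Real.sqrt ZP2 ≤ zBox Box + Real.sqrt TT := sqrt_sum_branchAmp_sq_le_add (Good := Good) hH
  have hZ'le : Real.sqrt ZP2 ≤ 2 * zBox Box := by nlinarith [Real.sqrt_nonneg ZP2]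
  have hZle : zBox Box ≤ Real.sqrt ZP2 := by
    -- `Z² = Σ_x ρ² ≤ Σ_{y,s} ψ²` (every box point lies in its own fibre and the terms are nonnegative)
    unfold zBox
    refine Real.sqrt_le_sqrt ?_
    have hmaps : ∀ x ∈ Box, (yOf x, sOf x) ∈ (Box.image yOf) ×ˢ (univ : Finset (Fin m → ZMod (2 ^ κ))) :=
      fun x hx => mem_product.2 ⟨mem_image_of_mem _ hx, mem_univ _⟩
    rw [← sum_fiberwise_of_maps_to hmaps, hZP2, sum_product]
    refine sum_le_sum fun y hy => sum_le_sum fun s _ => ?_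
    obtain ⟨x₀, hx₀, rfl⟩ := mem_image.1 hy
    have hset : Box.filter (fun x => (yOf x, sOf x) = (yOf x₀, s)) = fibre Λ e (2 ^ κ) Box (yOf x₀) s := by
      rw [← filter_yOf_sOf_eq_fibre hH hx₀ s]
      exact filter_congr fun x _ => by simp only [Prod.mk.injEq]
    rw [hset, branchAmp_eq_sum_fibre]
    exact sum_sq_le_sq_sum_of_nonneg fun _ _ => (gaussianFunction_pos _ _).le
  refine ⟨?_, hZle, hZ'le⟩
  calc l2Norm (phiState Box lab₀ κc - phiIdeal Λ e S base enc Box yOf) ≤ 2 / zBox Box * Real.sqrt TT :=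
        l2Norm_phiState_sub_phiIdeal_le hH hR hne
    _ ≤ 2 / zBox Box * (C * (2 * zBox Box)) := by
        refine mul_le_mul_of_nonneg_left (hsqrtTT.trans (mul_le_mul_of_nonneg_left hZ'le hC0)) (by positivity)
    _ = 4 * C := by field_simp; ring

end QPart

end Regev2009

end Literature.Algebra.EuclideanLattices
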